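import Summits.PneNP.PneNP.Theorems.ExpanderLinearGeneratorsResolutionNFreeMaster
import HarnessLib

/-!
# The n-free resolution-size rung for expanding linear systems, IV: the law

Support file for crux `stmt-PneNP-11442`
(`Summit.PneNP.PneNP.Theses.ExpanderLinearGenerators.ExpansionForcesDepthFregeSize`). The crux is
the EXPANSION-SCALE LAW for bounded-depth Frege, stated uniformly in the numbers `n` of variables
and `m` of rows. For RESOLUTION the tree holds the n-free width rung (Ben-Sasson–Wigderson,
Krajíček's Lemma 13.4.5) and the n-dependent size rung (`exp(w²/n)`, Krajíček's Cor. 13.4.6, void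
once `n ≥ r²`). This file closes the chain I–III with an n-free, m-free SIZE law for resolution in
exactly the crux's vocabulary (`resolution_size_nfree`):

  for every `ℓ ≥ 1` and `0 < ε < 1` there is `R` such that for all real `r ≥ R`, all `n, m`, every
  `ℓ`-sparse `E : Fin m → LinEqMod 2 n` whose supports form an `(r, 3ℓ/4)`-boundary expander, and
  every resolution refutation `π` of `sumEncoding 1 E`:
  `|π| ≥ r^{(1-ε)⌈3ℓ/4⌉} / 2^{ℓ+1}`.

The degree `(1-ε)⌈3ℓ/4⌉` grows with the locality `ℓ`; the bound is polynomial in the expansion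
scale — the restriction method provably stops there (the overload term of the master inequality),
and an n-free bound of the form `2^{r^ε}` for resolution is not in print. Proof: the master
inequality of file III with load `L = ⌈3ℓ/4⌉ - 1`, width `W = ⌈(3ℓ/4 - L) r / 2⌉ - 1` and
sampling rate `1/(K+1)`, `K + 1 = ⌈r^{1-ε}⌉`; the second term is `≤ exp(-r^ε/64)`, eventually
below the first.

References: E. Ben-Sasson, A. Wigderson, J. ACM 48 (2001), Cor. 3.6, Thm. 6.5; P. Beame,
T. Pitassi, FOCS 1996; J. Krajíček, *Proof complexity* (CUP 2019), Lemma 13.4.5, Cor. 13.4.6,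
Problem 19.4.5.
-/

namespace Summit.PneNP.PneNP.Theorems.ResNFree

set_option linter.dupNamespace false -- `Summit.PneNP.PneNP.…`: summit = sub-problem (D-0017)

open Finset Filter Topology Literature.Computability.Complexity Literature.Computability.MetaComplexity
open Summit.PneNP.PneNP.Theorems.ResKRestriction

/-- `r^a · exp(-r^ε/64) ≤ B` for all large `r` (`ε > 0`, `B > 0`). [folklore] -/
theorem eventually_rpow_mul_exp_le (a : ℝ) {ε : ℝ} (hε : 0 < ε) {B : ℝ} (hB : 0 < B) :
    ∀ᶠ r : ℝ in atTop, r ^ a * Real.exp (-(r ^ ε) / 64) ≤ B := by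
  have h1 : Tendsto (fun x : ℝ => x ^ (a / ε) * Real.exp (-(1 / 64) * x)) atTop (𝓝 0) :=
    tendsto_rpow_mul_exp_neg_mul_atTop_nhds_zero (a / ε) (1 / 64) (by norm_num)
  have h2 := h1.comp (tendsto_rpow_atTop hε)
  have h3 : ∀ᶠ r : ℝ in atTop,
      ((fun x : ℝ => x ^ (a / ε) * Real.exp (-(1 / 64) * x)) ∘ fun r : ℝ => r ^ ε) r ≤ B :=
    h2.eventually (ge_mem_nhds hB)
  filter_upwards [h3, eventually_ge_atTop 0] with r hr hr0
  have h4 : (r ^ ε) ^ (a / ε) = r ^ a := by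
    rw [← Real.rpow_mul hr0, mul_div_cancel₀ a hε.ne']
  have h5 : -(r ^ ε) / 64 = -(1 / 64) * r ^ ε := by ring
  simp only [Function.comp_apply, h4] at hr
  rw [h5]
  exact hr

/-- **The n-free resolution-size law at expansion scale `r`.** For every locality `ℓ ≥ 1` and
`0 < ε < 1` there is `R` such that for all `r ≥ R`, all `n, m`, every `ℓ`-sparse system
`E : Fin m → LinEqMod 2 n` whose supports form an `(r, 3ℓ/4)`-boundary expander, every resolution
refutation of `sumEncoding 1 E` has at least `r^{(1-ε)⌈3ℓ/4⌉} / 2^{ℓ+1}` lines — independently of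
`n` and `m`. [Ben-Sasson–Wigderson 2001, Thm. 6.5; Beame–Pitassi 1996; Krajíček 2019, §13.4]
[folklore] -/
theorem resolution_size_nfree (ℓ : ℕ) (hℓ : 1 ≤ ℓ) (ε : ℝ) (hε : 0 < ε) (hε1 : ε < 1) :
    ∃ R : ℝ, ∀ r : ℝ, R ≤ r → ∀ (n m : ℕ) (E : Fin m → LinEqMod 2 n),
      (∀ i, (E i).supp.card ≤ ℓ) →
      IsBoundaryExpander (fun i => (E i).supp.map Fin.valEmbedding) r (3 / 4 * ℓ) →
      ∀ π : List (ResLine ℕ), IsResRefutation (sumEncoding 1 E) π →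
        r ^ ((1 - ε) * ⌈(3 : ℝ) / 4 * ℓ⌉₊) / 2 ^ (ℓ + 1) ≤ (π.length : ℝ) := by
  -- the constants `c = 3ℓ/4`, `T = ⌈c⌉`, `L = T - 1`
  set c : ℝ := 3 / 4 * ℓ with hc
  have hℓ' : (1 : ℝ) ≤ ℓ := by exact_mod_cast hℓ
  have hcpos : 0 < c := by rw [hc]; positivity
  set T : ℕ := ⌈c⌉₊ with hT
  have hT1 : 1 ≤ T := Nat.one_le_iff_ne_zero.2 (Nat.ceil_pos.2 hcpos).ne'
  set L : ℕ := T - 1 with hL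
  have hLT : L + 1 = T := Nat.sub_add_cancel hT1
  have hLreal : (L : ℝ) = T - 1 := by
    have : ((L + 1 : ℕ) : ℝ) = T := by exact_mod_cast hLT
    push_cast at this
    linarith
  have hLc : (L : ℝ) < c := by
    have h1 : (T : ℝ) < c + 1 := Nat.ceil_lt_add_one hcpos.le
    linarith
  -- `c - L ≥ 1/4`: `4 (c - L) = 3ℓ - 4T + 4` is a positive integer
  have hcL4 : (1 : ℝ) / 4 ≤ c - L := by
    have hz : (0 : ℝ) < ((3 * (ℓ : ℤ) - 4 * (T : ℤ) + 4 : ℤ) : ℝ) := by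
      push_cast
      rw [hc] at hLc
      linarith
    have hz' : (0 : ℤ) < 3 * (ℓ : ℤ) - 4 * (T : ℤ) + 4 := by exact_mod_cast hz
    have hz1 : (1 : ℤ) ≤ 3 * (ℓ : ℤ) - 4 * (T : ℤ) + 4 := hz'
    have hz1' : ((1 : ℤ) : ℝ) ≤ ((3 * (ℓ : ℤ) - 4 * (T : ℤ) + 4 : ℤ) : ℝ) := by exact_mod_cast hz1
    push_cast at hz1'
    rw [hc, hLreal]
    linarith
  -- eventual conditions on `r`
  have hev : ∀ᶠ r : ℝ in atTop, r ^ ((1 - ε) * T) * Real.exp (-(r ^ ε) / 64) ≤ 2 ^ ℓ :=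
    eventually_rpow_mul_exp_le _ hε (by positivity)
  obtain ⟨R, hR⟩ := Filter.eventually_atTop.1 (hev.and (eventually_ge_atTop (2 : ℝ)))
  refine ⟨R, fun r hr n m E hsparse hexp π hπ => ?_⟩
  obtain ⟨hr1, hr2⟩ := hR r hr
  have hr0 : 0 < r := by linarith
  -- the width threshold `W`
  set x : ℝ := (c - L) * r / 2 with hx
  have hxge : r / 8 ≤ x := by rw [hx]; nlinarith
  have hxpos : 0 < x := by linarith
  set W : ℕ := ⌈x⌉₊ - 1 with hWdef
  have hW1 : 1 ≤ ⌈x⌉₊ := Nat.one_le_iff_ne_zero.2 (Nat.ceil_pos.2 hxpos).ne'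
  have hWreal : (W : ℝ) = ⌈x⌉₊ - 1 := by
    have : ((W + 1 : ℕ) : ℝ) = ⌈x⌉₊ := by rw [hWdef]; exact_mod_cast Nat.sub_add_cancel hW1
    push_cast at this
    linarith
  have hWx : (W : ℝ) < x := by
    have h1 : (⌈x⌉₊ : ℝ) < x + 1 := Nat.ceil_lt_add_one hxpos.le
    linarith
  have hWge : x - 1 ≤ W := by
    have h1 : x ≤ (⌈x⌉₊ : ℝ) := Nat.le_ceil x
    linarith
  -- the sampling rate `1/(K+1)`, `K + 1 = ⌈r^{1-ε}⌉`
  set K : ℕ := ⌈r ^ (1 - ε)⌉₊ - 1 with hKdef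
  have hrpow : 0 < r ^ (1 - ε) := Real.rpow_pos_of_pos hr0 _
  have hK1 : 1 ≤ ⌈r ^ (1 - ε)⌉₊ := Nat.one_le_iff_ne_zero.2 (Nat.ceil_pos.2 hrpow).ne'
  have hKeq : (K : ℝ) + 1 = ⌈r ^ (1 - ε)⌉₊ := by
    have : ((K + 1 : ℕ) : ℝ) = ⌈r ^ (1 - ε)⌉₊ := by
      rw [hKdef]; exact_mod_cast Nat.sub_add_cancel hK1
    push_cast at this
    exact this
  have hKge : r ^ (1 - ε) ≤ (K : ℝ) + 1 := by rw [hKeq]; exact Nat.le_ceil _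
  have hKle : (K : ℝ) + 1 ≤ r ^ (1 - ε) + 1 := by
    rw [hKeq]; exact (Nat.ceil_lt_add_one hrpow.le).le
  -- the master inequality
  have hM := one_le_length_mul E hexp hr2 K hsparse hLc (by rw [← hx]; exact hWx) hπ
  -- the first term
  set t : ℝ := 2 ^ ℓ / r ^ ((1 - ε) * T) with ht
  have hra : 0 < r ^ ((1 - ε) * T) := Real.rpow_pos_of_pos hr0 _
  have htpos : 0 < t := by rw [ht]; positivity
  have ht1 : (2 : ℝ) ^ ℓ / ((K : ℝ) + 1) ^ (L + 1) ≤ t := by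
    rw [ht, hLT]
    refine div_le_div_of_nonneg_left (by positivity) hra ?_
    calc r ^ ((1 - ε) * T) = (r ^ (1 - ε)) ^ (T : ℕ) := by
          rw [Real.rpow_mul hr0.le, Real.rpow_natCast]
      _ ≤ ((K : ℝ) + 1) ^ T := pow_le_pow_left₀ hrpow.le hKge T
  -- the second term
  have ht2 : ((2 * (K : ℝ) + 1) / (2 * K + 2)) ^ (W / 2 + 1) ≤ t := by
    have hK0 : (0 : ℝ) < 2 * (K : ℝ) + 2 := by positivity
    have hbase : (2 * (K : ℝ) + 1) / (2 * K + 2) = -(1 / (2 * K + 2)) + 1 := by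
      field_simp; ring
    have hbase_le : (2 * (K : ℝ) + 1) / (2 * K + 2) ≤ Real.exp (-(1 / (2 * K + 2))) := by
      rw [hbase]; exact Real.add_one_le_exp _
    have hbase0 : (0 : ℝ) ≤ (2 * (K : ℝ) + 1) / (2 * K + 2) := by positivity
    -- `q = W/2 + 1 ≥ r/16`
    have hq : r / 16 ≤ ((W / 2 + 1 : ℕ) : ℝ) := by
      have hdm := Nat.div_add_mod W 2
      have hmod : W % 2 ≤ 1 := Nat.lt_succ_iff.1 (Nat.mod_lt _ (by norm_num))
      have h1 : ((2 * (W / 2) + W % 2 : ℕ) : ℝ) = W := by exact_mod_cast hdm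
      have h2 : ((W % 2 : ℕ) : ℝ) ≤ 1 := by exact_mod_cast hmod
      push_cast at h1 ⊢
      linarith
    have hstep1 : ((2 * (K : ℝ) + 1) / (2 * K + 2)) ^ (W / 2 + 1)
        ≤ Real.exp (-(1 / (2 * K + 2))) ^ (W / 2 + 1) := pow_le_pow_left₀ hbase0 hbase_le _
    have hstep2 : Real.exp (-(1 / (2 * (K : ℝ) + 2))) ^ (W / 2 + 1)
        = Real.exp (((W / 2 + 1 : ℕ) : ℝ) * -(1 / (2 * K + 2))) := by
      rw [Real.exp_nat_mul]
    have hstep3 : Real.exp (((W / 2 + 1 : ℕ) : ℝ) * -(1 / (2 * (K : ℝ) + 2)))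
        ≤ Real.exp (-(r ^ ε) / 64) := by
      rw [Real.exp_le_exp]
      have h2K : 2 * (K : ℝ) + 2 ≤ 4 * r ^ (1 - ε) := by
        have : (1 : ℝ) ≤ r ^ (1 - ε) := Real.one_le_rpow (by linarith) (by linarith)
        linarith
      have hprod : r ^ ε * r ^ (1 - ε) = r := by
        rw [← Real.rpow_add hr0]; norm_num
      have hrε : 0 ≤ r ^ ε := (Real.rpow_pos_of_pos hr0 _).le
      -- `r^ε / 64 ≤ q / (2K+2)`
      have hq' : r ^ ε / 64 ≤ ((W / 2 + 1 : ℕ) : ℝ) / (2 * K + 2) := by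
        rw [div_le_div_iff₀ (by norm_num) hK0]
        calc r ^ ε * (2 * (K : ℝ) + 2) ≤ r ^ ε * (4 * r ^ (1 - ε)) :=
              mul_le_mul_of_nonneg_left h2K hrε
          _ = 4 * r := by rw [mul_left_comm, hprod]
          _ ≤ ((W / 2 + 1 : ℕ) : ℝ) * 64 := by linarith
      have : ((W / 2 + 1 : ℕ) : ℝ) * -(1 / (2 * (K : ℝ) + 2))
          = -(((W / 2 + 1 : ℕ) : ℝ) / (2 * K + 2)) := by ring
      rw [this, neg_div]
      exact neg_le_neg hq'
    have hstep4 : Real.exp (-(r ^ ε) / 64) ≤ t := by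
      rw [ht, le_div_iff₀ hra, mul_comm]
      exact hr1
    calc ((2 * (K : ℝ) + 1) / (2 * K + 2)) ^ (W / 2 + 1)
        ≤ Real.exp (-(1 / (2 * K + 2))) ^ (W / 2 + 1) := hstep1
      _ = Real.exp (((W / 2 + 1 : ℕ) : ℝ) * -(1 / (2 * K + 2))) := hstep2
      _ ≤ Real.exp (-(r ^ ε) / 64) := hstep3
      _ ≤ t := hstep4
  -- conclusion
  have hsum : (2 : ℝ) ^ ℓ / ((K : ℝ) + 1) ^ (L + 1) +
      ((2 * (K : ℝ) + 1) / (2 * K + 2)) ^ (W / 2 + 1) ≤ 2 * t := by linarith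
  have hlen : (1 : ℝ) ≤ π.length * (2 * t) :=
    hM.trans (mul_le_mul_of_nonneg_left hsum (Nat.cast_nonneg _))
  have hgoal : r ^ ((1 - ε) * T) / 2 ^ (ℓ + 1) = 1 / (2 * t) := by
    rw [ht]
    field_simp
    ring
  rw [hgoal, div_le_iff₀ (by positivity)]
  linarith

end Summit.PneNP.PneNP.Theorems.ResNFree
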